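import Mathlib
import Literature.NumberTheory.Transcendental.MultipleZetaValues
import Literature.NumberTheory.Transcendental.HolonomyBoundModule

/-!
# Sketch — crux `HoffmanIndependence` (stmt-KontsevichZagierPeriods-15045), crux-ideate round 2, ideator 4

First lemmas of the idea card `hadamard-parity-pairing` (signatures over existing declarations).

* `Crux`                         — the crux verbatim (= `Theses.LinRedNormalForm.HoffmanIndependence`, `rfl`).
* `rung3_of_crux`                — the first open block `{1, ζ(2), ζ(3)}` (the target of the line) is an
                                   instance of the crux.
* `hadamardSection`, `hadamardSection_eq_remainders` (PROVED) — under a ℚ-relation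
  `α + βζ(2) + γζ(3) = 0` the Hadamard pairing of two Apéry-type tables
  `R_n = α a₂(n)a₃(n) + β b₂(n)a₃(n) + γ a₂(n)b₃(n)` equals the combination of REMAINDERS
  `β (b₂(n) − ζ(2)a₂(n)) a₃(n) + γ a₂(n)(b₃(n) − ζ(3)a₃(n))` — a rational sequence with the decay of
  the remainders: the "relation section" of the Hadamard template.
* `hadamardSection_den` (PROVED) — its denominator type is `[1..n]^3` as soon as
  `a₂, a₃ ∈ ℤ`, `d_n² b₂ ∈ ℤ`, `d_n³ b₃ ∈ ℤ` (no type doubling: τ = 3, not 5).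
* `apery2A/B`, `apery3A/B`      — the two Apéry tables by their recurrences (`native_decide` checks).
* `OverconvergentAlong`, `rung3_of_holonomyWitness` (stated) — the shape of the concluding step: a map `φ`
  along which EVERY relation section and its first `k` Euler derivatives continue holomorphically, with
  `(k+1)(log|φ'(0)| − 3) > 2 log sup_𝕋|φ|`, contradicts the tree's PROVED basic holonomy bound
  `HolonomyBound.holonomyBound_basic'` once the Euler family is `ℚ[x]`-independent; i.e. such a
  witness gives rung 3.
-/

namespace Summit.KontsevichZagierPeriods.KontsevichZagierPeriods.Cruxes.HoffmanIndependence.Ideator4Sketch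

open Literature.NumberTheory.Transcendental MZV Filter Topology Metric
open scoped BigOperators

/-- The crux VERBATIM (signature of `Theses.LinRedNormalForm.HoffmanIndependence`). -/
abbrev Crux : Prop :=
  LinearIndependent ℚ (fun u : {u : List ℕ // IsHoffman u} => multipleZeta u.1)

/-- The Hoffman words `∅, (2), (3)`. -/
def rung3Words : Fin 3 → {u : List ℕ // IsHoffman u} :=
  ![⟨[], fun _ h => by simp at h⟩, ⟨[2], fun i h => by simp at h; omega⟩,
    ⟨[3], fun i h => by simp at h; omega⟩]

theorem rung3Words_injective : Function.Injective rung3Words := by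
  intro i j h
  fin_cases i <;> fin_cases j <;> simp_all [rung3Words]

/-- Rung 3 (`1, ζ(2), ζ(3)` linearly independent over `ℚ`; open) — the target of the line. -/
def Rung3 : Prop := LinearIndependent ℚ (fun i : Fin 3 => multipleZeta (rung3Words i).1)

/-- Rung 3 is an instance of the crux. -/
theorem rung3_of_crux (h : Crux) : Rung3 :=
  h.comp rung3Words rung3Words_injective

/-! ### The Hadamard relation section -/

/-- The Hadamard pairing of two Apéry-type tables under coefficients `(α, β, γ)`:
`R_n = α a₂(n)a₃(n) + β b₂(n)a₃(n) + γ a₂(n)b₃(n)` (the `n`-th coefficient of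
`α A₂⋆A₃ + β B₂⋆A₃ + γ A₂⋆B₃`). -/
def hadamardSection (α β γ : ℚ) (a₂ b₂ a₃ b₃ : ℕ → ℚ) (n : ℕ) : ℚ :=
  α * (a₂ n * a₃ n) + β * (b₂ n * a₃ n) + γ * (a₂ n * b₃ n)

/-- **Relation section = combination of remainders.** Under `α + βζ(2) + γζ(3) = 0` the (rational)
Hadamard section equals `β (b₂ − ζ(2)a₂) a₃ + γ a₂ (b₃ − ζ(3)a₃)` termwise; in particular it inherits the
geometric decay of the two Apéry remainders (radius `R₂ r₃` resp. `r₂ R₃` for the two terms). PROVED. -/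
theorem hadamardSection_eq_remainders (α β γ : ℚ) (a₂ b₂ a₃ b₃ : ℕ → ℚ)
    (hrel : (α : ℝ) + β * multipleZeta [2] + γ * multipleZeta [3] = 0) (n : ℕ) :
    ((hadamardSection α β γ a₂ b₂ a₃ b₃ n : ℚ) : ℝ) =
      β * (((b₂ n : ℝ) - multipleZeta [2] * a₂ n) * a₃ n) +
        γ * ((a₂ n : ℝ) * ((b₃ n : ℝ) - multipleZeta [3] * a₃ n)) := by
  unfold hadamardSection
  push_cast
  linear_combination ((a₂ n : ℝ) * a₃ n) * hrel

/-- **Denominator type `[1..n]^3` (not `[1..n]^5`).** With `d = lcm(1..n)` (any common multiple works):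
integral `a₂, a₃`, `d² b₂ ∈ ℤ`, `d³ b₃ ∈ ℤ` give `d³ R_n ∈ ℤ` for integer `α, β, γ`. PROVED. -/
theorem hadamardSection_den (α β γ : ℤ) (a₂ b₂ a₃ b₃ : ℕ → ℚ) (n : ℕ) (d : ℤ)
    (ha₂ : ∃ z : ℤ, a₂ n = z) (ha₃ : ∃ z : ℤ, a₃ n = z)
    (hb₂ : ∃ z : ℤ, (d : ℚ) ^ 2 * b₂ n = z) (hb₃ : ∃ z : ℤ, (d : ℚ) ^ 3 * b₃ n = z) :
    ∃ z : ℤ, (d : ℚ) ^ 3 * hadamardSection α β γ a₂ b₂ a₃ b₃ n = z := by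
  obtain ⟨x₂, hx₂⟩ := ha₂; obtain ⟨x₃, hx₃⟩ := ha₃; obtain ⟨y₂, hy₂⟩ := hb₂; obtain ⟨y₃, hy₃⟩ := hb₃
  refine ⟨d ^ 3 * α * x₂ * x₃ + d * β * y₂ * x₃ + γ * x₂ * y₃, ?_⟩
  unfold hadamardSection
  rw [hx₂, hx₃]
  have e₂ : b₂ n * (d : ℚ) ^ 2 = y₂ := by rw [mul_comm]; exact hy₂
  have e₃ : b₃ n * (d : ℚ) ^ 3 = y₃ := by rw [mul_comm]; exact hy₃
  push_cast
  linear_combination (d : ℚ) * β * (x₃ : ℚ) * e₂ + γ * (x₂ : ℚ) * e₃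

/-! ### The two Apéry tables (data) -/

/-- One step of Apéry's ζ(2) recurrence `n² uₙ = (11n² − 11n + 3) uₙ₋₁ + (n−1)² uₙ₋₂` (n ≥ 2). -/
def apery2Step (n : ℕ) (u₀ u₁ : ℚ) : ℚ :=
  (((11 : ℚ) * n ^ 2 - 11 * n + 3) * u₁ + ((n : ℚ) - 1) ^ 2 * u₀) / (n : ℚ) ^ 2

/-- One step of Apéry's ζ(3) recurrence `n³ uₙ = (2n−1)(17n² − 17n + 5) uₙ₋₁ − (n−1)³ uₙ₋₂` (n ≥ 2). -/
def apery3Step (n : ℕ) (u₀ u₁ : ℚ) : ℚ :=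
  ((2 * (n : ℚ) - 1) * (17 * (n : ℚ) ^ 2 - 17 * n + 5) * u₁ - ((n : ℚ) - 1) ^ 3 * u₀) / (n : ℚ) ^ 3

/-- `(uₙ, uₙ₊₁)` for a two-term recurrence from initial data. -/
def recPair (step : ℕ → ℚ → ℚ → ℚ) (u₀ u₁ : ℚ) : ℕ → ℚ × ℚ
  | 0 => (u₀, u₁)
  | n + 1 => let p := recPair step u₀ u₁ n; (p.2, step (n + 2) p.1 p.2)

/-- Apéry's ζ(2) numbers `1, 3, 19, 147, …` and their companion `0, 5, 125/4, …` (`bₙ/aₙ → ζ(2)`). -/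
def apery2A (n : ℕ) : ℚ := (recPair apery2Step 1 3 n).1
def apery2B (n : ℕ) : ℚ := (recPair apery2Step 0 5 n).1
/-- Apéry's ζ(3) numbers `1, 5, 73, 1445, …` and their companion `0, 6, 351/4, …` (`bₙ/aₙ → ζ(3)`). -/
def apery3A (n : ℕ) : ℚ := (recPair apery3Step 1 5 n).1
def apery3B (n : ℕ) : ℚ := (recPair apery3Step 0 6 n).1

example : apery2A 3 = 147 ∧ apery3A 3 = 1445 ∧ apery3B 2 = 351 / 4 ∧ apery2B 2 = 125 / 4 := by
  native_decide

/-! ### Shape of the concluding step (stated) -/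

/-- The coefficient sequence `c : ℕ → ℚ` continues holomorphically along `φ` on the disc of radius `R₀`:
there is `g` holomorphic on `|z| < R₀` whose germ at `0` is `Σ c_k φ(z)^k`. -/
def OverconvergentAlong (c : ℕ → ℚ) (φ : ℂ → ℂ) (R₀ : ℝ) : Prop :=
  ∃ g : ℂ → ℂ, DifferentiableOn ℂ g (ball (0 : ℂ) R₀) ∧
    ∀ᶠ z in 𝓝 (0 : ℂ), HasSum (fun k => ((c k : ℚ) : ℂ) * φ z ^ k) (g z)

/-- Euler derivative on coefficient sequences (`θ = x d/dx`: `c_k ↦ k c_k`), iterated. -/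
def eulerIter (j : ℕ) (c : ℕ → ℚ) (k : ℕ) : ℚ := (k : ℚ) ^ j * c k

/-- **HOLONOMY WITNESS FOR RUNG 3 (the line's load-bearing package, stated).** A map `φ`, holomorphic on a
disc of radius `R₀ > 1`, `φ(0) = 0`, bounded by `M ≥ 1` on the unit circle, such that for EVERY rational
triple `(α,β,γ) ≠ 0` satisfying the relation, the Hadamard section of the two Apéry tables and its first `k`
Euler derivatives continue holomorphically along `φ`, are `ℚ[x]`-linearly independent, and the numerology
`(k+1)·(log|φ'(0)| − 3) > 2 log M` holds (denominator type `[1..n]^3`, i.e. `Σ b_j = 3`). By the tree's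
PROVED bound `HolonomyBound.holonomyBound_basic'` such a configuration is contradictory, so no relation
exists. (For the Apéry ζ(2) × Apéry ζ(3) pair the card's Model-A estimate is `log|φ'(0)| ≈ 3.15`, a
near-tie with no room for `k`; the card's design criterion `d = min(R₂r₃, r₂R₃) ≳ 0.65` is what a
growth-matched pair must meet.) -/
def HolonomyWitnessRung3 : Prop :=
  ∃ (φ : ℂ → ℂ) (R₀ M : ℝ) (k : ℕ), 1 < R₀ ∧ 1 ≤ M ∧ DifferentiableOn ℂ φ (ball (0 : ℂ) R₀) ∧ φ 0 = 0 ∧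
    (∀ z : ℂ, ‖z‖ = 1 → ‖φ z‖ ≤ M) ∧
    2 * Real.log M < (k + 1 : ℝ) * (Real.log ‖deriv φ 0‖ - 3) ∧
    ∀ α β γ : ℚ, (α, β, γ) ≠ 0 →
      (α : ℝ) + β * multipleZeta [2] + γ * multipleZeta [3] = 0 →
        (∀ j ≤ k, OverconvergentAlong
            (eulerIter j (hadamardSection α β γ apery2A apery2B apery3A apery3B)) φ R₀) ∧
        LinearIndependent (Polynomial ℚ) (fun j : Fin (k + 1) =>
          PowerSeries.mk (eulerIter j (hadamardSection α β γ apery2A apery2B apery3A apery3B)))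

/-- **Rung 3 from a holonomy witness** (stated; the proof is bookkeeping around
`HolonomyBound.holonomyBound_basic'` with `b = (1,1,1)`, `a i k = d_k³ · (k^i R_k)`, plus a uniform bound of
the pulled-back germs on the unit circle obtained by shrinking `R₀`). -/
theorem rung3_of_holonomyWitness (h : HolonomyWitnessRung3) : Rung3 := by
  sorry

/-- The tree's engine, for reference (PROVED there). -/
example := @HolonomyBound.holonomyBound_basic'

end Summit.KontsevichZagierPeriods.KontsevichZagierPeriods.Cruxes.HoffmanIndependence.Ideator4Sketch
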